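import Literature.ModelTheory.FiniteModelTheory.LFPArith
import Literature.ModelTheory.FiniteModelTheory.CodeLayout
import Literature.ModelTheory.FiniteModelTheory.ESOInputBits
import HarnessLib

/-!
# FO(IFP) with order reads the code of its own structure

Topic `Literature/ModelTheory/FiniteModelTheory`; step 3 of the discharge of
`Literature.ModelTheory.FiniteModelTheory.exists_sentence_natOrder_of_mem_P` (Gurevich 1984, §4 Theorems 2–3,
(1) → (3)). The machine of a polynomial-time class reads the CODE of the structure,
`codeOf R = (encodingSNPInstance ar).encode ⟨N, R⟩ = boolPair (encodeNat N) (tables as a bit array)`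
(`SNP.lean`, `BoolEncodings.lean`, and `CodeLayout.lean` of this topic, which proves where every
bit sits: `getElem?_codeOf_header/sep0/sep1/table`, `length_codeOf`, `tableOffset`,
`relTablesEquiv_apply_table`, `exists_table_decomp`; zero-padding of digit tuples, `padT` and
`tval_eq_of_high_zero`, comes from `ESOInputBits.lean`). This file

* rephrases that layout for the base-`N` tuple arithmetic of `LFPArith.lean`: the block offsets
  `boff ar N i` by recursion on the symbol index `i : ℕ` (the IFP builder `isOffT` recurses on
  `i`, and `inLenT` needs `i = ar.length`; `boff_eq_tableOffset` identifies it with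
  `tableOffset`), `val_finSigmaFinEquiv_boff`, `getElem?_codeOf_boff` (the bit of table `i` at
  tuple `v` sits at `2|bin N| + 2 + boff i + tval v`), `length_codeOf_eq_clen`, `exists_block`,
  and the binary length of `N` (`length_encodeNat_spec/unique`, from `Nat.size`);
* defines, with the arithmetic of `LFPArith.lean`, the builders `isLenT` (the binary length of
  `N`), `isDblLenT`, `binRegionT`, `binBitT`, `sep2T`, `isOffT i` (offset of table block `i`),
  `tabBitT i` (a `true` entry of table `i`, using the input atom `R_i`), and finally
  `inLenT p̄` / `inTrueT p̄` with `eval_inLenT : … ↔ tval p̄ < |code|` and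
  `eval_inTrueT : … ↔ code[tval p̄]? = some true` (hypotheses `2 ≤ d`, arities `< d`, `2 ≤ N`,
  `|code| < N ^ d`) — the input builders required by `LFPSimulation.lean`.

## References

* Y. Gurevich, *Toward logic tailored for computational complexity*, LNM 1104 (1984), §3
  Provisos 2–3 (structures on `{0,…,|S|-1}`, standard array representation), §4 (printed p. 202).
* R. Impagliazzo, R. Paturi, F. Zane, JCSS 63 (2001), §3 (tables as bit arrays; `SNP.lean`).
* L. Libkin, *Elements of Finite Model Theory*, Springer 2004, §6.1 (the layout, via `CodeLayout.lean`).
-/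

namespace Literature.ModelTheory.FiniteModelTheory.LFPCode

open _root_.Computability Literature.Computability.Complexity Literature.Computability.Cryptography

/-! ## The code of a structure, position by position -/

section Layout

variable {ar : List ℕ} {N : ℕ}

/-- The length `ℓ = |bin N|` of `encodeNat N`, `N ≥ 1`: `1 ≤ ℓ` and `2 ^ (ℓ - 1) ≤ N < 2 ^ ℓ`
(`TM2Pass.length_encodeNat_eq_size` and `Nat.size`). [folklore] -/
theorem length_encodeNat_spec (hN : 1 ≤ N) :
    1 ≤ (encodeNat N).length ∧ 2 ^ ((encodeNat N).length - 1) ≤ N ∧ N < 2 ^ (encodeNat N).length := by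
  rw [TM2Pass.length_encodeNat_eq_size]
  have h1 : 1 ≤ Nat.size N := Nat.size_pos.mpr hN
  exact ⟨h1, Nat.lt_size.mp (by omega), Nat.lt_size_self N⟩

/-- The length of `encodeNat N` is determined by `1 ≤ ℓ`, `2 ^ (ℓ - 1) ≤ N < 2 ^ ℓ`
(`Nat.size_le`, `Nat.lt_size`). [folklore] -/
theorem length_encodeNat_unique {ℓ : ℕ} (h1 : 1 ≤ ℓ) (h2 : 2 ^ (ℓ - 1) ≤ N) (h3 : N < 2 ^ ℓ) :
    ℓ = (encodeNat N).length := by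
  rw [TM2Pass.length_encodeNat_eq_size]
  have := Nat.size_le.mpr h3
  have := Nat.lt_size.mpr h2
  omega

/-- `2 ^ |bin N| ≤ 2N` for `N ≥ 2`. [folklore] -/
theorem two_pow_length_encodeNat_le (hN : 2 ≤ N) : 2 ^ (encodeNat N).length ≤ 2 * N := by
  obtain ⟨g1, g2, -⟩ := length_encodeNat_spec (N := N) (by omega)
  have : 2 ^ (encodeNat N).length = 2 * 2 ^ ((encodeNat N).length - 1) := by
    rw [← pow_succ']; congr 1; omega
  omega

/-- Offsets of the table blocks inside the table part of the code, by recursion on the symbol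
index (`= tableOffset` of `CodeLayout.lean` on `i < ar.length`, `boff_eq_tableOffset`; also
defined at `i = ar.length`, the total table length, `boff_length`). [folklore] -/
def boff (ar : List ℕ) (N : ℕ) : ℕ → ℕ
  | 0 => 0
  | i + 1 => boff ar N i + N ^ ar.getD i 0

/-- `boff` as a `Fin`-indexed sum (the form of `finSigmaFinEquiv_apply`). [folklore] -/
theorem boff_eq_sum (i : ℕ) (hi : i ≤ ar.length) :
    boff ar N i = ∑ i' : Fin i, N ^ ar.get (Fin.castLE hi i') := by
  induction i with
  | zero => simp [boff]
  | succ i ih =>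
    rw [boff, ih (by omega), Fin.sum_univ_castSucc]
    congr 1
    rw [List.getD_eq_getElem _ _ (by omega)]
    rfl

/-- `boff` agrees with `tableOffset` (`CodeLayout.lean`) on symbol indices. [folklore] -/
theorem boff_eq_tableOffset (s : Fin ar.length) : boff ar N s = tableOffset ar N s := by
  rw [boff_eq_sum _ s.2.le]; rfl

/-- The total table length is `tableBits`. [folklore] -/
theorem boff_length : boff ar N ar.length = tableBits ar N := by
  rw [boff_eq_sum _ le_rfl, tableBits]
  rfl

/-- `boff` is monotone. [folklore] -/
theorem boff_mono {i j : ℕ} (h : i ≤ j) : boff ar N i ≤ boff ar N j := by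
  induction h with
  | refl => exact le_rfl
  | step _ ih => exact ih.trans (by rw [boff]; omega)

/-- `boff (i + 1) = boff i + N ^ (ar.get i)`. [folklore] -/
theorem boff_succ_of_lt (i : Fin ar.length) : boff ar N (i + 1) = boff ar N i + N ^ ar.get i := by
  rw [boff, List.getD_eq_getElem _ _ i.2]; rfl

/-- The code length of the structure `⟨N, R⟩`: `2|bin N| + 2 + boff ar N |ar|`. [folklore] -/
abbrev clen (ar : List ℕ) (N : ℕ) : ℕ := 2 * (encodeNat N).length + 2 + boff ar N ar.length

/-- The position of (symbol `i`, tuple `v`) in the table part is `boff i + tval v`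
(`val_finSigmaFinEquiv_table` of `CodeLayout.lean` in `boff`/`tval` form). [folklore] -/
theorem val_finSigmaFinEquiv_boff (i : Fin ar.length) (v : Fin (ar.get i) → Fin N) :
    ((finSigmaFinEquiv (⟨i, finFunctionFinEquiv v⟩ : Σ i : Fin ar.length, Fin (N ^ ar.get i)) : Fin (tableBits ar N)) : ℕ)
      = boff ar N i + tval v := by
  rw [val_finSigmaFinEquiv_table, boff_eq_tableOffset]; rfl

/-- **The code of a structure at a table position**: the bit of table `i` at tuple `v` sits at
`2|bin N| + 2 + boff i + tval v` (`getElem?_codeOf_table` and the layout lemma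
`relTablesEquiv_apply_table` of `CodeLayout.lean`). [folklore] -/
theorem getElem?_codeOf_boff (R : RelTables ar N) (i : Fin ar.length) (v : Fin (ar.get i) → Fin N) :
    (codeOf R)[2 * (encodeNat N).length + 2 + (boff ar N i + tval v)]? = some (R i v) := by
  rw [← val_finSigmaFinEquiv_boff, TM2Pass.length_encodeNat_eq_size,
    getElem?_codeOf_table R (Fin.is_lt _), Fin.eta, relTablesEquiv_apply_table]

/-- The length of the code of a structure is `clen ar N` (`length_codeOf`). [folklore] -/
theorem length_codeOf_eq_clen (R : RelTables ar N) : (codeOf R).length = clen ar N := by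
  rw [length_codeOf, clen, TM2Pass.length_encodeNat_eq_size, boff_length]

/-- Locating a table position: every offset in the table part lies in a block
(`exists_table_decomp` of `CodeLayout.lean` in `boff`/`tval` form). [folklore] -/
theorem exists_block {q : ℕ} (hq : q < tableBits ar N) :
    ∃ (i : Fin ar.length) (v : Fin (ar.get i) → Fin N), q = boff ar N i + tval v := by
  obtain ⟨s, w, h⟩ := exists_table_decomp hq
  exact ⟨s, w, by rw [← val_finSigmaFinEquiv_boff, h]⟩

end Layout

/-! ## The input word in FO(IFP) with order: positions of the code of the structure -/

section InputFormulas

open Literature.Computability.Complexity Literature.Computability.Cryptography _root_.Computability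

variable {ar : List ℕ} {d : ℕ}

/-- The arity of symbol `i` as a digit index (`< d`). [folklore] -/
def arityIdx (hd : 2 ≤ d) (hda : ∀ a ∈ ar, a < d) (i : ℕ) : Fin d :=
  ⟨ar.getD i 0, by
    by_cases h : i < ar.length
    · rw [List.getD_eq_getElem _ _ h]; exact hda _ (List.getElem_mem h)
    · rw [List.getD_eq_default _ _ (not_lt.mp h)]; omega⟩

variable {rv' : List ℕ} {m : ℕ}

/-- `λ̄ = ℓ`, the number of binary digits of `N`: `1 ≤ λ`, `2^(λ-1) ≤ N < 2^λ`. [cite: Gurevich1984, §4 (printed p. 202: FO + LFP with order speaks about the digits of binary notation)] -/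
def isLenT (hd : 2 ≤ d) (lam : Fin d → Fin m) : Formula (2 :: ar) rv' m :=
  .and (.not (Formula.zeroT lam))
    (.and
      (Formula.exs d    -- z = 2^λ, N < z
        (.and (Formula.powTwoT (Fin.castAdd d ∘ lam) (Fin.natAdd m))
          (Formula.exs d   -- nn = N
            (.and (Formula.isPowT ⟨1, hd⟩ (Fin.natAdd (m + d)))
              (Formula.ltT (Fin.natAdd (m + d)) (Fin.castAdd d ∘ Fin.natAdd m))))))
      (Formula.exs d    -- lam0 = λ - 1
        (.and (Formula.succT (Fin.natAdd m) (Fin.castAdd d ∘ lam))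
          (Formula.exs d  -- z0 = 2^lam0
            (.and (Formula.powTwoT (Fin.castAdd d ∘ Fin.natAdd m) (Fin.natAdd (m + d)))
              (Formula.exs d  -- nn = N, ¬ nn < z0
                (.and (Formula.isPowT ⟨1, hd⟩ (Fin.natAdd (m + d + d)))
                  (.not (Formula.ltT (Fin.natAdd (m + d + d)) (Fin.castAdd d ∘ Fin.natAdd (m + d)))))))))))

/-- `μ̄ = 2ℓ`. [folklore] -/
def isDblLenT (hd : 2 ≤ d) (mu : Fin d → Fin m) : Formula (2 :: ar) rv' m :=
  Formula.exs d (.and (isLenT hd (Fin.natAdd m)) (Formula.dblT (Fin.natAdd m) (Fin.castAdd d ∘ mu)))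

/-- `p̄ < 2ℓ` (the binary part of the code). [folklore] -/
def binRegionT (hd : 2 ≤ d) (p : Fin d → Fin m) : Formula (2 :: ar) rv' m :=
  Formula.exs d (.and (isDblLenT hd (Fin.natAdd m)) (Formula.ltT (Fin.castAdd d ∘ p) (Fin.natAdd m)))

/-- The binary digit `⌊p/2⌋` of `N` is `1`. [cite: Gurevich1984, §4 (printed p. 202: FO + LFP with order speaks about the digits of binary notation)] -/
def binBitT (hd : 2 ≤ d) (p : Fin d → Fin m) : Formula (2 :: ar) rv' m :=
  Formula.exs d (.and (Formula.halfT (Fin.castAdd d ∘ p) (Fin.natAdd m))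
    (Formula.exs d (.and (Formula.divPowTwoT ⟨1, hd⟩ (Fin.castAdd d ∘ Fin.natAdd m) (Fin.natAdd (m + d)))
      (Formula.oddT (Fin.natAdd (m + d))))))

/-- `p̄ = 2ℓ + 1` (the separator bit `true`). [folklore] -/
def sep2T (hd : 2 ≤ d) (p : Fin d → Fin m) : Formula (2 :: ar) rv' m :=
  Formula.exs d (.and (isDblLenT hd (Fin.natAdd m)) (Formula.succT (Fin.natAdd m) (Fin.castAdd d ∘ p)))

/-- `ō = 2ℓ + 2 + boff i`, the offset of table block `i`. [folklore] -/
def isOffT (hd : 2 ≤ d) (hda : ∀ a ∈ ar, a < d) : ℕ → {m : ℕ} → (Fin d → Fin m) → Formula (2 :: ar) rv' m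
  | 0, m, o => Formula.exs d (.and (isDblLenT hd (Fin.natAdd m)) (Formula.shiftT 2 (Fin.natAdd m) (Fin.castAdd d ∘ o)))
  | i + 1, m, o => Formula.exs d (.and (isOffT hd hda i (Fin.natAdd m))
      (Formula.exs d (.and (Formula.isPowT (arityIdx hd hda i) (Fin.natAdd (m + d)))
        (Formula.addT (Fin.castAdd d ∘ Fin.natAdd m) (Fin.natAdd (m + d)) (Fin.castAdd d ∘ Fin.castAdd d ∘ o)))))

/-- The bit at `p̄` is a `true` entry of table `i`: `p̄ = off i + idx(ȳ)` with `R_i(ȳ)`. [folklore] -/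
def tabBitT (hd : 2 ≤ d) (hda : ∀ a ∈ ar, a < d) (i : Fin ar.length) (p : Fin d → Fin m) :
    Formula (2 :: ar) rv' m :=
  Formula.exs d   -- o
    (.and (isOffT hd hda i (Fin.natAdd m))
      (Formula.exs d  -- y
        (.and (Formula.iAnd fun l : Fin d => if ar.get i ≤ (l : ℕ) then Formula.zeroV (Fin.natAdd (m + d) l) else .verum)
          (.and (Formula.addT (Fin.castAdd d ∘ Fin.natAdd m) (Fin.natAdd (m + d)) (Fin.castAdd d ∘ Fin.castAdd d ∘ p))
            (Formula.tab i fun l : Fin (ar.get i) =>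
              Fin.natAdd (m + d) ⟨l, lt_of_lt_of_le l.2 (hda _ (List.get_mem ar i)).le⟩)))))

/-- `p̄ < n`, the length of the code. [folklore] -/
def inLenT (hd : 2 ≤ d) (hda : ∀ a ∈ ar, a < d) (p : Fin d → Fin m) : Formula (2 :: ar) rv' m :=
  Formula.exs d (.and (isOffT hd hda ar.length (Fin.natAdd m)) (Formula.ltT (Fin.castAdd d ∘ p) (Fin.natAdd m)))

/-- The bit of the code at `p̄` is `true`. [cite: Gurevich1984, §4 (printed p. 202: FO + LFP with order speaks about the digits of binary notation)] -/
def inTrueT (hd : 2 ≤ d) (hda : ∀ a ∈ ar, a < d) (p : Fin d → Fin m) : Formula (2 :: ar) rv' m :=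
  .or (.and (binRegionT hd p) (binBitT hd p))
    (.or (sep2T hd p) (Formula.iOr fun i : Fin ar.length => tabBitT hd hda i p))

/-! ### Semantics -/

variable {N : ℕ} (R : RelTables ar N) (V' : RVAssign rv' N)

/-- Semantics of `isLenT`: the value is the binary length of `N` (`N ≥ 2`, `2N < N ^ d`). [folklore] -/
theorem eval_isLenT (hd : 2 ≤ d) (hN : 2 ≤ N) (h2N : 2 * N < N ^ d) (τ : Fin m → Fin N) (lam : Fin d → Fin m) :
    (isLenT hd lam : Formula (2 :: ar) rv' m).eval (withNatOrder R) V' τ ↔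
      tval (τ ∘ lam) = (encodeNat N).length := by
  simp only [isLenT, Formula.eval_and', Formula.eval_not', Formula.eval_zeroT, Formula.eval_exs,
    Formula.eval_powTwoT, Formula.eval_isPowT R _ _ hN, Formula.eval_ltT, Formula.eval_succT, pow_one]
  have e1 : ∀ a : Fin d → Fin N, Fin.append τ a ∘ (Fin.castAdd d ∘ lam) = τ ∘ lam := fun a => by funext i; simp
  have e2 : ∀ a b : Fin d → Fin N, Fin.append (Fin.append τ a) b ∘ Fin.natAdd (m + d) = b := fun a b => by
    funext i; simp
  have e3 : ∀ a b : Fin d → Fin N, Fin.append (Fin.append τ a) b ∘ (Fin.castAdd d ∘ Fin.natAdd m) = a :=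
    fun a b => by funext i; simp
  have e4 : ∀ a b c : Fin d → Fin N, Fin.append (Fin.append (Fin.append τ a) b) c ∘ Fin.natAdd (m + d + d) = c :=
    fun a b c => by funext i; simp
  have e5 : ∀ a b c : Fin d → Fin N,
      Fin.append (Fin.append (Fin.append τ a) b) c ∘ (Fin.castAdd d ∘ Fin.natAdd (m + d)) = b :=
    fun a b c => by funext i; simp
  simp only [e1, e2, e3, e4, e5, append_comp_natAdd]
  obtain ⟨g1, g2, g3⟩ := length_encodeNat_spec (N := N) (by omega)
  have hb := two_pow_length_encodeNat_le hN
  constructor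
  · rintro ⟨hne, ⟨z, hz, nn, hnn, hlt⟩, lam0, hlam0, z0, hz0, nn', hnn', hge⟩
    apply length_encodeNat_unique (by omega)
    · rw [hnn'] at hge; rw [hz0] at hge
      have : tval lam0 = tval (τ ∘ lam) - 1 := by omega
      rw [this] at hge; omega
    · rw [hnn, hz] at hlt; exact hlt
  · intro h
    have hNd : N < N ^ d := by omega
    refine ⟨by omega, ?_, ?_⟩
    · obtain ⟨z, hz⟩ := exists_tval_eq (N := N) (d := d) (m := 2 ^ (encodeNat N).length) (by omega)
      obtain ⟨nn, hnn⟩ := exists_tval_eq (N := N) (d := d) (m := N) hNd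
      exact ⟨z, by rw [hz, h], nn, hnn, by rw [hnn, hz]; exact g3⟩
    · obtain ⟨lam0, hlam0⟩ := exists_tval_eq (N := N) (d := d) (m := (encodeNat N).length - 1)
        (by have := tval_lt (τ ∘ lam); omega)
      obtain ⟨z0, hz0⟩ := exists_tval_eq (N := N) (d := d) (m := 2 ^ ((encodeNat N).length - 1)) (by omega)
      obtain ⟨nn, hnn⟩ := exists_tval_eq (N := N) (d := d) (m := N) hNd
      exact ⟨lam0, by omega, z0, by rw [hz0, hlam0], nn, hnn, by rw [hnn, hz0]; exact not_lt.mpr g2⟩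


/-- `2N < N ^ d` once the code length is below `N ^ d` (`d ≥ 2`, `N ≥ 2`). [folklore] -/
theorem two_N_lt' (hN : 2 ≤ N) (hbig : clen ar N < N ^ d) (hd : 2 ≤ d) : 2 * N < N ^ d := by
  have h4 : 2 * N ≤ N * N := Nat.mul_le_mul_right N hN
  have : N * N ≤ N ^ d := by
    calc N * N = N ^ 2 := by ring
      _ ≤ N ^ d := Nat.pow_le_pow_right (by omega) hd
  rcases Nat.lt_or_ge (2 * N) (N ^ d) with h | h
  · exact h
  · exfalso
    -- 2N ≥ N^d ≥ N², so N ≤ 2, N = 2, d with 2^d ≤ 4 → d = 2; clen ≥ 2*2+2 = 6 > 4 contradiction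
    have hN2 : N = 2 := by nlinarith
    subst hN2
    have hlen : (encodeNat 2).length = 2 := by decide
    unfold clen at hbig
    rw [hlen] at hbig
    omega

section Sem

variable (hd : 2 ≤ d) (hda : ∀ a ∈ ar, a < d) (hN : 2 ≤ N) (hbig : clen ar N < N ^ d)
include hN hbig

/-- Semantics of `isDblLenT`: twice the binary length of `N`. [folklore] -/
theorem eval_isDblLenT (τ : Fin m → Fin N) (mu : Fin d → Fin m) :
    (isDblLenT hd mu : Formula (2 :: ar) rv' m).eval (withNatOrder R) V' τ ↔
      tval (τ ∘ mu) = 2 * (encodeNat N).length := by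
  have h2N := two_N_lt' hN hbig hd
  simp only [isDblLenT, Formula.eval_exs, Formula.eval_and', eval_isLenT R V' hd hN h2N, Formula.eval_dblT,
    append_comp_natAdd, append_comp_castAdd]
  constructor
  · rintro ⟨a, h1, h2⟩; omega
  · intro h
    obtain ⟨a, ha⟩ := exists_tval_eq (N := N) (d := d) (m := (encodeNat N).length)
      (by unfold clen at hbig; omega)
    exact ⟨a, ha, by omega⟩

/-- Semantics of `binRegionT`: the position lies in the (doubled) binary part of the code. [folklore] -/
theorem eval_binRegionT (τ : Fin m → Fin N) (p : Fin d → Fin m) :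
    (binRegionT hd p : Formula (2 :: ar) rv' m).eval (withNatOrder R) V' τ ↔
      tval (τ ∘ p) < 2 * (encodeNat N).length := by
  simp only [binRegionT, Formula.eval_exs, Formula.eval_and', eval_isDblLenT R V' hd hN hbig, Formula.eval_ltT,
    append_comp_natAdd, append_comp_castAdd]
  constructor
  · rintro ⟨a, h1, h2⟩; omega
  · intro h
    obtain ⟨a, ha⟩ := exists_tval_eq (N := N) (d := d) (m := 2 * (encodeNat N).length)
      (by unfold clen at hbig; omega)
    exact ⟨a, ha, by omega⟩

omit hbig in
/-- Semantics of `binBitT`: binary digit `⌊p/2⌋` of `N` is `1`. [folklore] -/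
theorem eval_binBitT (τ : Fin m → Fin N) (p : Fin d → Fin m) :
    (binBitT hd p : Formula (2 :: ar) rv' m).eval (withNatOrder R) V' τ ↔
      N / 2 ^ (tval (τ ∘ p) / 2) % 2 = 1 := by
  have hp2 : tval (τ ∘ p) / 2 < N ^ d := lt_of_le_of_lt (Nat.div_le_self _ _) (tval_lt _)
  have hNd : N < N ^ d := by
    have h1 : N * N ≤ N ^ d := by
      calc N * N = N ^ 2 := (sq N).symm
        _ ≤ N ^ d := Nat.pow_le_pow_right (by omega) hd
    have h2 : N < N * N := by nlinarith
    omega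
  have hpow1 : N ^ ((⟨1, hd⟩ : Fin d) : ℕ) = N := pow_one N
  simp only [binBitT, Formula.eval_exs, Formula.eval_and', Formula.eval_halfT, Formula.eval_divPowTwoT R _ _ hN,
    Formula.eval_oddT, append_comp_natAdd, append_comp_castAdd, hpow1]
  constructor
  · rintro ⟨a, ha, b, hb, hodd⟩; rw [hb, ha] at hodd; exact hodd
  · intro h
    obtain ⟨a, ha⟩ := exists_tval_eq (N := N) (d := d) (m := tval (τ ∘ p) / 2) hp2
    obtain ⟨b, hb⟩ := exists_tval_eq (N := N) (d := d) (m := N / 2 ^ (tval (τ ∘ p) / 2))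
      (lt_of_le_of_lt (Nat.div_le_self _ _) hNd)
    exact ⟨a, ha, b, by rw [hb, ha], by rw [hb]; exact h⟩

/-- Semantics of `sep2T`: the position of the separator bit `true`. [folklore] -/
theorem eval_sep2T (τ : Fin m → Fin N) (p : Fin d → Fin m) :
    (sep2T hd p : Formula (2 :: ar) rv' m).eval (withNatOrder R) V' τ ↔
      tval (τ ∘ p) = 2 * (encodeNat N).length + 1 := by
  simp only [sep2T, Formula.eval_exs, Formula.eval_and', eval_isDblLenT R V' hd hN hbig, Formula.eval_succT,
    append_comp_natAdd, append_comp_castAdd]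
  constructor
  · rintro ⟨a, h1, h2⟩; omega
  · intro h
    obtain ⟨a, ha⟩ := exists_tval_eq (N := N) (d := d) (m := 2 * (encodeNat N).length)
      (by unfold clen at hbig; omega)
    exact ⟨a, ha, by omega⟩

/-- Semantics of `isOffT i`: the offset of table block `i` in the code. [folklore] -/
theorem eval_isOffT : ∀ (i : ℕ) (_ : i ≤ ar.length) {m : ℕ} (V' : RVAssign rv' N) (τ : Fin m → Fin N)
    (o : Fin d → Fin m),
    (isOffT hd hda i o : Formula (2 :: ar) rv' m).eval (withNatOrder R) V' τ ↔
      tval (τ ∘ o) = 2 * (encodeNat N).length + 2 + boff ar N i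
  | 0, _, m, V', τ, o => by
    simp only [isOffT, Formula.eval_exs, Formula.eval_and', eval_isDblLenT R V' hd hN hbig, Formula.eval_shiftT,
      append_comp_natAdd, append_comp_castAdd, boff]
    constructor
    · rintro ⟨a, h1, h2⟩; omega
    · intro h
      obtain ⟨a, ha⟩ := exists_tval_eq (N := N) (d := d) (m := 2 * (encodeNat N).length)
        (by unfold clen at hbig; omega)
      exact ⟨a, ha, by omega⟩
  | i + 1, hi, m, V', τ, o => by
    simp only [isOffT, Formula.eval_exs, Formula.eval_and', eval_isOffT i (by omega), Formula.eval_isPowT R _ _ hN,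
      Formula.eval_addT, append_comp_natAdd, append_comp_castAdd, arityIdx]
    have hgi : ar.getD i 0 = ar.get ⟨i, hi⟩ := by rw [List.getD_eq_getElem _ _ hi]; rfl
    have hb : boff ar N (i + 1) = boff ar N i + N ^ ar.getD i 0 := rfl
    constructor
    · rintro ⟨a, ha, b, hb', hsum⟩
      rw [hsum, ha, hb', hb]; omega
    · intro h
      have hmono : boff ar N (i + 1) ≤ boff ar N ar.length := boff_mono hi
      obtain ⟨a, ha⟩ := exists_tval_eq (N := N) (d := d) (m := 2 * (encodeNat N).length + 2 + boff ar N i)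
        (by unfold clen at hbig; rw [hb] at hmono; omega)
      obtain ⟨b, hb'⟩ := exists_tval_eq (N := N) (d := d) (m := N ^ ar.getD i 0)
        (by unfold clen at hbig; rw [hb] at hmono; omega)
      exact ⟨a, ha, b, hb', by rw [h, ha, hb', hb]; omega⟩


/-- Semantics of `tabBitT i`: the position is that of a `true` entry of table `i`. [folklore] -/
theorem eval_tabBitT (τ : Fin m → Fin N) (i : Fin ar.length) (p : Fin d → Fin m) :
    (tabBitT hd hda i p : Formula (2 :: ar) rv' m).eval (withNatOrder R) V' τ ↔
      ∃ v : Fin (ar.get i) → Fin N, tval (τ ∘ p) = 2 * (encodeNat N).length + 2 + boff ar N i + tval v ∧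
        R i v = true := by
  have hai : ar.get i ≤ d := (hda _ (List.get_mem ar i)).le
  simp only [tabBitT, Formula.eval_exs, Formula.eval_and', eval_isOffT R hd hda hN hbig i i.2.le,
    Formula.eval_iAnd, Formula.eval_addT, Formula.eval_tab, append_comp_natAdd, append_comp_castAdd]
  have e1 : ∀ (a b : Fin d → Fin N) (l : Fin d), (Formula.eval (withNatOrder R)
      (if ar.get i ≤ (l : ℕ) then (Formula.zeroV (Fin.natAdd (m + d) l) : Formula (2 :: ar) rv' (m + d + d))
        else Formula.verum) V' (Fin.append (Fin.append τ a) b)) ↔ (ar.get i ≤ (l : ℕ) → (b l : ℕ) = 0) := by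
    intro a b l
    by_cases h : ar.get i ≤ (l : ℕ)
    · rw [if_pos h]; simp only [Formula.eval_zeroV, Fin.append_right]
      exact ⟨fun h' _ => h', fun h' => h' h⟩
    · rw [if_neg h]; simp only [Formula.eval_verum]
      exact ⟨fun _ h' => absurd h' h, fun _ => trivial⟩
  simp only [e1]
  have harg : ∀ (o y : Fin d → Fin N), (Fin.append (Fin.append τ o) y ∘ fun l : Fin (ar.get i) =>
      Fin.natAdd (m + d) (⟨l, lt_of_lt_of_le l.2 hai⟩ : Fin d)) = y ∘ Fin.castLE hai := by
    intro o y; funext l; simp only [Function.comp_apply, Fin.append_right]; exact congrArg y (Fin.ext rfl)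
  constructor
  · rintro ⟨o, ho, y, hy, hsum, hrel⟩
    refine ⟨y ∘ Fin.castLE hai, ?_, ?_⟩
    · rw [hsum, ho, tval_eq_of_high_zero hai y hy]; rfl
    · rw [harg] at hrel; exact hrel
  · rintro ⟨v, hv, hrel⟩
    obtain ⟨o, ho⟩ := exists_tval_eq (N := N) (d := d) (m := 2 * (encodeNat N).length + 2 + boff ar N i)
      (by have := tval_lt (τ ∘ p); omega)
    have hN0 : 0 < N := by omega
    -- pad `v` with zero digits to width `d` (`padT`, `padT_high`, `padT_comp_castLE` of `ESOInputBits.lean`)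
    have htv : tval (padT (K := d) hN0 v) = tval v := by
      rw [tval_eq_of_high_zero hai _ (padT_high hN0 v), padT_comp_castLE]; rfl
    refine ⟨o, ho, padT (K := d) hN0 v, padT_high hN0 v, ?_, ?_⟩
    · rw [htv, ho, hv]
    · rw [harg, padT_comp_castLE]; exact hrel

/-- Semantics of `inLenT`: the position is below the code length. [folklore] -/
theorem eval_inLenT (τ : Fin m → Fin N) (p : Fin d → Fin m) :
    (inLenT hd hda p : Formula (2 :: ar) rv' m).eval (withNatOrder R) V' τ ↔ tval (τ ∘ p) < clen ar N := by
  simp only [inLenT, Formula.eval_exs, Formula.eval_and', eval_isOffT R hd hda hN hbig ar.length le_rfl,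
    Formula.eval_ltT, append_comp_natAdd, append_comp_castAdd, clen]
  constructor
  · rintro ⟨a, h1, h2⟩; omega
  · intro h
    obtain ⟨a, ha⟩ := exists_tval_eq (N := N) (d := d) (m := clen ar N) hbig
    exact ⟨a, ha, by unfold clen at ha; omega⟩

/-- **Semantics of `inTrueT`**: the bit of the code of `⟨N, R⟩` at position `p̄` is `true`. [cite: Gurevich1984, §4 (printed p. 202: FO + LFP with order speaks about the digits of binary notation)] -/
theorem eval_inTrueT (τ : Fin m → Fin N) (p : Fin d → Fin m) :
    (inTrueT hd hda p : Formula (2 :: ar) rv' m).eval (withNatOrder R) V' τ ↔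
      ((encodingSNPInstance ar).encode ⟨N, R⟩)[tval (τ ∘ p)]? = some true := by
  change _ ↔ (codeOf R)[tval (τ ∘ p)]? = some true
  have hsz : 2 * (encodeNat N).length = 2 * Nat.size N := by rw [TM2Pass.length_encodeNat_eq_size]
  simp only [inTrueT, Formula.eval_or', Formula.eval_and', eval_binRegionT R V' hd hN hbig, eval_binBitT R V' hd hN,
    eval_sep2T R V' hd hN hbig, Formula.eval_iOr, eval_tabBitT R V' hd hda hN hbig]
  constructor
  · rintro (⟨hlt, hbit⟩ | h2 | ⟨i, v, hv, hrel⟩)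
    · rw [getElem?_codeOf_header R (by omega), Nat.testBit_eq_decide_div_mod_eq, hbit]; rfl
    · rw [h2, hsz]; exact getElem?_codeOf_sep1 R
    · rw [hv, Nat.add_assoc, getElem?_codeOf_boff R i v, hrel]
  · intro h
    have hlen : tval (τ ∘ p) < clen ar N := by
      by_contra hge
      rw [List.getElem?_eq_none (by rw [length_codeOf_eq_clen]; exact not_lt.mp hge)] at h
      simp at h
    rcases Nat.lt_or_ge (tval (τ ∘ p)) (2 * (encodeNat N).length) with hlt | hge
    · left
      refine ⟨hlt, ?_⟩
      rw [getElem?_codeOf_header R (by omega), Nat.testBit_eq_decide_div_mod_eq] at h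
      simpa using h
    · right
      rcases Nat.lt_or_ge (tval (τ ∘ p)) (2 * (encodeNat N).length + 2) with hlt2 | hge2
      · rcases (by omega : tval (τ ∘ p) = 2 * (encodeNat N).length ∨
            tval (τ ∘ p) = 2 * (encodeNat N).length + 1) with h0 | h1
        · rw [h0, hsz, getElem?_codeOf_sep0] at h; simp at h
        · exact Or.inl h1
      · right
        obtain ⟨i, v, hiv⟩ := exists_block (ar := ar) (N := N) (q := tval (τ ∘ p) - (2 * (encodeNat N).length + 2))
          (by rw [← boff_length]; unfold clen at hlen; omega)
        refine ⟨i, v, by omega, ?_⟩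
        have := getElem?_codeOf_boff R i v
        rw [← hiv, show 2 * (encodeNat N).length + 2 + (tval (τ ∘ p) - (2 * (encodeNat N).length + 2)) =
          tval (τ ∘ p) by omega, h] at this
        exact (Option.some.inj this).symm

end Sem

end InputFormulas

end Literature.ModelTheory.FiniteModelTheory.LFPCode
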